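import Mathlib.Analysis.Calculus.ContDiff.Bounds
import Literature.Analysis.FluidPDE.NashRankOneDecomposition
import Literature.Analysis.FunctionSpaces.FlatTorus
import HarnessLib

/-!
# Nash coefficient fields `x ↦ Γ_j(Id + c₀ T(x)/D)` of a tensor field on `T³`
# (Coiculescu–Palasek 2025, Def. 3.5 with Lemma 6.1; Lemma 3.6 and Prop. 3.13 (abounds))

Analysis/FluidPDE support file (two definitions with proved API; no named facts) on the discharge
path of the principal-parts hypothesis `hA` of
`Literature.Barriers.NavierStokesRegularity.CriticalDataSmoothNonuniqueness_of_principalParts_of_perturbationLe`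
(M. P. Coiculescu, S. Palasek, *Non-uniqueness of smooth solutions of the Navier–Stokes equations from
critical data*, Invent. Math. 244 (2025), arXiv:2503.14699). The amplitudes of the data iteration,
**Def. 3.5**, are

  `a_{j,k}(x) = N_k (2‖𝒟ψ⁰_{k-1}‖_∞ / (c₀|η_j|²A_{j,k}))^{1/2} χ_k(x) Γ_j(Id + c₀ 𝒟ψ⁰_{k-1}(x)/‖𝒟ψ⁰_{k-1}‖_∞)`,

"well-defined because the tensor at which we evaluate `Γ_j` lies in the domain" `B(Id, c₀)` of the
Nash lemma (Lemma 6.1, the tree's `CP25.nash_lemma`). This file isolates the nonlinear ingredient,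
the **coefficient field** `x ↦ Γ_j(Id + (c₀/D) T(x))` of a tensor field `T : T³ → ℝ^{3×3}` normalised
by any bound `D ≥ ‖T‖_∞` (the paper takes `D = ‖T‖_∞`; every `D > 0` with `‖T(x)‖ ≤ D` keeps the
argument in `B(Id, c₀)`, and the cancellation of Rmk. 3.12 only uses that the same `D` appears in the
prefactor and in the argument), and proves what Lemma 3.6, Prop. 3.7, Rmk. 3.12 and Prop. 3.13 use of it:

* `CP25.nashArg T D x = Id + (c₀/D) • T x` and `CP25.nashField j T D x = Γ_j(nashArg T D x)`;
* `CP25.dist_nashArg_idMat_le` — the argument lies in `B(Id, c₀)` when `‖T x‖ ≤ D`, `0 < D`;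
* `CP25.nashField_mem_Icc` — `1/10 ≤ Γ_j(…) ≤ 1` (Lemma 6.1 (Gammabound));
* `CP25.sum_nashField_sq_mul` — **the Nash identity along the field**:
  `∑_j Γ_j(nashArg)² θ_{ja}θ_{jb} = δ_{ab} + (c₀/D) T_{ab}(x)` for symmetric `T` (Lemma 6.1; this is
  the computation of Rmk. 3.12, `∑_j Γ_j²(Id + c₀𝒟ψ/‖𝒟ψ‖) θ_j ⊗ θ_j = Id + c₀𝒟ψ/‖𝒟ψ‖`);
* `CP25.isSmooth_nashField` — smoothness for smooth `T` (`Γ_j ∈ C^∞(B)`);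
* `CP25.exists_norm_iteratedFDeriv_lift_nashField_le` — **all-orders bounds, uniform in the field**:
  for each `j, n` a constant `C` (depending on nothing else) with
  `‖Dⁿ(Γ_j ∘ nashArg ∘ proj)(y)‖ ≤ C Λⁿ` whenever `‖Dⁱ(T ∘ proj)(y)‖ ≤ (D/c₀) Λⁱ` for `1 ≤ i ≤ n`
  (Lemma 6.1 (GammaboundII) `‖∇^mΓ_j‖_{L^∞(B)} ≲_m 1` with the Faà di Bruno bound
  `‖Dⁿ(g ∘ f)‖ ≤ n! C Λⁿ`, Mathlib's `norm_iteratedFDeriv_comp_le'`). This is the form in which the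
  chain rule enters the proof of Lemma 3.6 ("`|∇(Γ_j(Id + c₀𝒟ψ/‖𝒟ψ‖))| ≲ ‖∇𝒟ψ‖_∞/‖𝒟ψ‖_∞` using
  (Gammabound)") and the all-orders estimate (abounds) of the proof of Prop. 3.13, with constants
  independent of the level `k` and of the scale parameter `A`.

## Mathlib / tree search

Tree: `CP25.idMat`, `CP25.nashCoeff`, `CP25.nashRadius`, `CP25.nashCoeff_mem_Icc`,
`CP25.nash_decomposition`, `CP25.contDiffOn_nashCoeff`, `CP25.exists_bound_iteratedFDeriv_nashCoeff`
(`FluidPDE/NashRankOneDecomposition`); `Torus.lift`, `Torus.IsSmooth` (`FunctionSpaces/FlatTorus`).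
Mathlib: `norm_iteratedFDeriv_comp_le'`, `ContDiffOn.comp_contDiff`, `iteratedFDeriv_const_smul_apply`,
`iteratedFDeriv_add_apply`, `iteratedFDeriv_const_of_ne`. `lean search 'nashArg|nashField|Γ_j ∘'`: nothing prior.

## References

* M. P. Coiculescu, S. Palasek, Invent. Math. 244 (2025) 165–219, doi:10.1007/s00222-025-01396-z,
  arXiv:2503.14699: Def. 3.5, Lemma 3.6 (proof), Rmk. 3.12, Prop. 3.13 (proof, (abounds)), Lemma 6.1.
  [CoiculescuPalasek2025]
-/

noncomputable section

open Set Metric Function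
open scoped BigOperators ContDiff

namespace Literature.Analysis.FluidPDE

namespace CP25

open Literature.Analysis.FunctionSpaces Literature.Analysis.FunctionSpaces.Torus

/-! ## The objects -/

/-- **The normalised argument of the Nash coefficients**: `Id + (c₀/D) T(x)` for a tensor field
`T : T³ → ℝ^{3×3}` and a normalisation `D` (Def. 3.5: `Id + c₀ 𝒟ψ⁰_{k-1}(x)/‖𝒟ψ⁰_{k-1}‖_{L^∞}`).
[cite: CoiculescuPalasek2025, Def. 3.5] -/
def nashArg (T : UnitAddTorus (Fin 3) → (Fin 3 → Fin 3 → ℝ)) (D : ℝ) (x : UnitAddTorus (Fin 3)) :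
    Fin 3 → Fin 3 → ℝ :=
  idMat + (nashRadius / D) • T x

/-- **The Nash coefficient field** `x ↦ Γ_j(Id + (c₀/D) T(x))` (the factor
`Γ_j(Id + c₀ 𝒟ψ⁰_{k-1}(x)/‖𝒟ψ⁰_{k-1}‖_{L^∞})` of the amplitude `a_{j,k}` of Def. 3.5).
[cite: CoiculescuPalasek2025, Def. 3.5] -/
def nashField (j : Fin 6) (T : UnitAddTorus (Fin 3) → (Fin 3 → Fin 3 → ℝ)) (D : ℝ)
    (x : UnitAddTorus (Fin 3)) : ℝ :=
  nashCoeff j (nashArg T D x)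

variable {T : UnitAddTorus (Fin 3) → (Fin 3 → Fin 3 → ℝ)} {D : ℝ}

/-- Entries of the argument: `(Id + (c₀/D)T)_{ab} = δ_{ab} + (c₀/D) T_{ab}`. [folklore] -/
theorem nashArg_apply (T : UnitAddTorus (Fin 3) → (Fin 3 → Fin 3 → ℝ)) (D : ℝ)
    (x : UnitAddTorus (Fin 3)) (a b : Fin 3) :
    nashArg T D x a b = (if a = b then 1 else 0) + nashRadius / D * T x a b := by
  simp [nashArg, idMat]

/-- Unfolding. [folklore] -/
theorem nashField_apply (j : Fin 6) (T : UnitAddTorus (Fin 3) → (Fin 3 → Fin 3 → ℝ)) (D : ℝ)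
    (x : UnitAddTorus (Fin 3)) : nashField j T D x = nashCoeff j (nashArg T D x) := rfl

/-- `nashArg T D x - Id = (c₀/D) • T x`. [folklore] -/
theorem nashArg_sub_idMat (T : UnitAddTorus (Fin 3) → (Fin 3 → Fin 3 → ℝ)) (D : ℝ)
    (x : UnitAddTorus (Fin 3)) : nashArg T D x - idMat = (nashRadius / D) • T x := by
  simp [nashArg]

/-- **The argument lies in the ball `B(Id, c₀)`** when `‖T(x)‖ ≤ D` and `D > 0`
("`a_{j,k}` is well-defined because the tensor at which we evaluate `Γ_j` lies in the domain").
[cite: CoiculescuPalasek2025, Def. 3.5 (remark after it)] -/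
theorem dist_nashArg_idMat_le (hD : 0 < D) {x : UnitAddTorus (Fin 3)} (hT : ‖T x‖ ≤ D) :
    dist (nashArg T D x) idMat ≤ nashRadius := by
  rw [dist_eq_norm, nashArg_sub_idMat, norm_smul, Real.norm_eq_abs,
    abs_of_pos (div_pos nashRadius_pos hD), div_mul_eq_mul_div]
  have h0 : 0 ≤ nashRadius := nashRadius_pos.le
  calc nashRadius * ‖T x‖ / D ≤ nashRadius * D / D := by
        gcongr
    _ = nashRadius := by field_simp

/-- The argument lies in the larger ball of radius `2c₀ = 1/500` on which the tree's Nash lemma is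
proved. [folklore] -/
theorem dist_nashArg_idMat_le' (hD : 0 < D) {x : UnitAddTorus (Fin 3)} (hT : ‖T x‖ ≤ D) :
    dist (nashArg T D x) idMat ≤ 1 / 500 :=
  (dist_nashArg_idMat_le hD hT).trans (by norm_num [nashRadius])

/-- The argument lies in the OPEN ball of radius `2c₀`. [folklore] -/
theorem nashArg_mem_ball (hD : 0 < D) {x : UnitAddTorus (Fin 3)} (hT : ‖T x‖ ≤ D) :
    nashArg T D x ∈ ball idMat (1 / 500) :=
  mem_ball.2 ((dist_nashArg_idMat_le hD hT).trans_lt (by norm_num [nashRadius]))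

/-- The argument is symmetric when `T(x)` is. [folklore] -/
theorem nashArg_symm {x : UnitAddTorus (Fin 3)} (hTs : ∀ a b, T x a b = T x b a) (a b : Fin 3) :
    nashArg T D x a b = nashArg T D x b a := by
  rw [nashArg_apply, nashArg_apply, hTs a b]
  by_cases h : a = b
  · subst h; rfl
  · rw [if_neg h, if_neg (Ne.symm h)]

/-! ## Pointwise bounds and the Nash identity -/

/-- **`1/10 ≤ Γ_j(Id + (c₀/D)T(x)) ≤ 1`** (Lemma 6.1 (Gammabound), which prints `1/100 ≤ Γ_j ≤ 1`).
[cite: CoiculescuPalasek2025, Lemma 6.1 (Gammabound)] -/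
theorem nashField_mem_Icc (j : Fin 6) (hD : 0 < D) {x : UnitAddTorus (Fin 3)} (hT : ‖T x‖ ≤ D) :
    1 / 10 ≤ nashField j T D x ∧ nashField j T D x ≤ 1 :=
  nashCoeff_mem_Icc (dist_nashArg_idMat_le' hD hT) j

/-- `0 < Γ_j(…)`. [cite: CoiculescuPalasek2025, Lemma 6.1] -/
theorem nashField_pos (j : Fin 6) (hD : 0 < D) {x : UnitAddTorus (Fin 3)} (hT : ‖T x‖ ≤ D) :
    0 < nashField j T D x :=
  lt_of_lt_of_le (by norm_num) (nashField_mem_Icc j hD hT).1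

/-- `|Γ_j(…)| ≤ 1`. [cite: CoiculescuPalasek2025, Lemma 6.1] -/
theorem abs_nashField_le_one (j : Fin 6) (hD : 0 < D) {x : UnitAddTorus (Fin 3)} (hT : ‖T x‖ ≤ D) :
    |nashField j T D x| ≤ 1 := by
  rw [abs_of_pos (nashField_pos j hD hT)]
  exact (nashField_mem_Icc j hD hT).2

/-- `Γ_j(…)² = Γ_j²(…)`, the affine functional `CP25.nashCoeffSq` of the argument. [cite: CoiculescuPalasek2025, Lemma 6.1] -/
theorem nashField_sq (j : Fin 6) (hD : 0 < D) {x : UnitAddTorus (Fin 3)} (hT : ‖T x‖ ≤ D) :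
    nashField j T D x ^ 2 = nashCoeffSq (nashArg T D x) j :=
  nashCoeff_sq (dist_nashArg_idMat_le' hD hT) j

/-- **The Nash identity along the field** (Lemma 6.1 applied at `M = Id + (c₀/D)T(x)`, the
computation of Rmk. 3.12): for symmetric `T(x)` with `‖T(x)‖ ≤ D`,
`∑_j Γ_j(Id + (c₀/D)T(x))² θ_{ja} θ_{jb} = δ_{ab} + (c₀/D) T_{ab}(x)`.
[cite: CoiculescuPalasek2025, Lemma 6.1 and Rmk. 3.12] -/
theorem sum_nashField_sq_mul (hD : 0 < D) {x : UnitAddTorus (Fin 3)} (hT : ‖T x‖ ≤ D)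
    (hTs : ∀ a b, T x a b = T x b a) (a b : Fin 3) :
    ∑ j, nashField j T D x ^ 2 * ((nashDir j a : ℝ) * (nashDir j b : ℝ)) =
      (if a = b then 1 else 0) + nashRadius / D * T x a b := by
  rw [← nashArg_apply]
  exact (nash_decomposition (nashArg_symm hTs) (dist_nashArg_idMat_le' hD hT) a b).symm

/-! ## Smoothness -/

/-- The lift of the argument: `(nashArg T D) ∘ proj = Id + (c₀/D) • (T ∘ proj)`. [folklore] -/
theorem lift_nashArg (T : UnitAddTorus (Fin 3) → (Fin 3 → Fin 3 → ℝ)) (D : ℝ) :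
    lift (nashArg T D) = fun y => idMat + (nashRadius / D) • lift T y := by
  funext y
  simp [lift_apply, nashArg]

/-- The lift of the field: `(nashField j T D) ∘ proj = Γ_j ∘ ((nashArg T D) ∘ proj)`. [folklore] -/
theorem lift_nashField (j : Fin 6) (T : UnitAddTorus (Fin 3) → (Fin 3 → Fin 3 → ℝ)) (D : ℝ) :
    lift (nashField j T D) = nashCoeff j ∘ lift (nashArg T D) := rfl

/-- The argument is `Cⁿ` when `T` is. [folklore] -/
theorem isContDiff_nashArg {n : WithTop ℕ∞} (hT : IsContDiff n T) (D : ℝ) :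
    IsContDiff n (nashArg T D) := by
  unfold IsContDiff
  rw [lift_nashArg]
  exact contDiff_const.add (hT.const_smul _)

/-- The argument is smooth when `T` is. [folklore] -/
theorem isSmooth_nashArg (hT : IsSmooth T) (D : ℝ) : IsSmooth (nashArg T D) :=
  isContDiff_nashArg hT D

/-- **The coefficient field is smooth** for smooth `T` with `‖T‖_∞ ≤ D`, `D > 0` (`Γ_j ∈ C^∞(B)`,
Lemma 6.1, composed with the smooth argument). [cite: CoiculescuPalasek2025, Lemma 6.1 and Def. 3.5] -/
theorem isContDiff_nashField {n : WithTop ℕ∞} (j : Fin 6) (hT : IsContDiff n T) (hD : 0 < D)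
    (hTb : ∀ x, ‖T x‖ ≤ D) : IsContDiff n (nashField j T D) := by
  unfold IsContDiff
  rw [lift_nashField]
  refine (contDiffOn_nashCoeff j).comp_contDiff (isContDiff_nashArg hT D) fun y => ?_
  rw [lift_apply]
  exact mem_closedBall.2 (dist_nashArg_idMat_le' hD (hTb _))

/-- **The coefficient field is smooth** for smooth `T` with `‖T‖_∞ ≤ D`, `D > 0`.
[cite: CoiculescuPalasek2025, Lemma 6.1 and Def. 3.5] -/
theorem isSmooth_nashField (j : Fin 6) (hT : IsSmooth T) (hD : 0 < D) (hTb : ∀ x, ‖T x‖ ≤ D) :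
    IsSmooth (nashField j T D) :=
  isContDiff_nashField j hT hD hTb

/-- The coefficient field is continuous. [folklore] -/
theorem continuous_nashField (j : Fin 6) (hT : IsSmooth T) (hD : 0 < D) (hTb : ∀ x, ‖T x‖ ≤ D) :
    Continuous (nashField j T D) :=
  (isSmooth_nashField j hT hD hTb).continuous

/-! ## All-orders bounds, uniform in the field -/

/-- Derivatives of positive order of the lifted argument: `Dⁱ(Id + (c₀/D) T∘proj) = (c₀/D) Dⁱ(T∘proj)`
for `1 ≤ i` (the constant `Id` drops out). [folklore] -/
theorem iteratedFDeriv_lift_nashArg {i : ℕ} (hi : 1 ≤ i) (hT : IsSmooth T) (D : ℝ)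
    (y : EuclideanSpace ℝ (Fin 3)) :
    iteratedFDeriv ℝ i (lift (nashArg T D)) y = (nashRadius / D) • iteratedFDeriv ℝ i (lift T) y := by
  rw [lift_nashArg]
  have hTi : ContDiff ℝ (i : WithTop ℕ∞) (lift T) := hT.of_le (by exact_mod_cast le_top)
  have hs : ContDiff ℝ (i : WithTop ℕ∞) (fun y => (nashRadius / D) • lift T y) := hTi.const_smul _
  have h1 : (fun y => idMat + (nashRadius / D) • lift T y) =
      (fun _ => idMat) + fun y => (nashRadius / D) • lift T y := rfl
  rw [h1, iteratedFDeriv_add_apply contDiff_const.contDiffAt hs.contDiffAt,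
    iteratedFDeriv_const_of_ne (by omega) idMat, Pi.zero_apply, zero_add]
  exact iteratedFDeriv_const_smul_apply' hTi.contDiffAt

/-- Norms of the derivatives of positive order of the lifted argument. [folklore] -/
theorem norm_iteratedFDeriv_lift_nashArg {i : ℕ} (hi : 1 ≤ i) (hT : IsSmooth T) (hD : 0 < D)
    (y : EuclideanSpace ℝ (Fin 3)) :
    ‖iteratedFDeriv ℝ i (lift (nashArg T D)) y‖ = nashRadius / D * ‖iteratedFDeriv ℝ i (lift T) y‖ := by
  rw [iteratedFDeriv_lift_nashArg hi hT D y, norm_smul, Real.norm_eq_abs,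
    abs_of_pos (div_pos nashRadius_pos hD)]

/-- A single constant bounding `‖DⁱΓ_j‖` on the ball `B(Id, c₀)` for all `i ≤ n` (from
`CP25.exists_bound_iteratedFDeriv_nashCoeff`, Lemma 6.1 (GammaboundII)). [cite: CoiculescuPalasek2025, Lemma 6.1 (GammaboundII)] -/
theorem exists_forall_le_bound_iteratedFDeriv_nashCoeff (j : Fin 6) (n : ℕ) :
    ∃ C : ℝ, 0 ≤ C ∧ ∀ i ≤ n, ∀ M : Fin 3 → Fin 3 → ℝ, dist M idMat ≤ nashRadius →
      ‖iteratedFDeriv ℝ i (nashCoeff j) M‖ ≤ C := by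
  induction n with
  | zero =>
    obtain ⟨C, hC⟩ := exists_bound_iteratedFDeriv_nashCoeff j 0
    refine ⟨max C 0, le_max_right _ _, fun i hi M hM => ?_⟩
    rw [Nat.le_zero.1 hi]
    exact (hC M hM).trans (le_max_left _ _)
  | succ n ih =>
    obtain ⟨C, hC0, hC⟩ := ih
    obtain ⟨C', hC'⟩ := exists_bound_iteratedFDeriv_nashCoeff j (n + 1)
    refine ⟨max C C', hC0.trans (le_max_left _ _), fun i hi M hM => ?_⟩
    rcases Nat.lt_or_ge i (n + 1) with h | h
    · exact (hC i (Nat.lt_succ_iff.1 h) M hM).trans (le_max_left _ _)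
    · rw [le_antisymm hi h]
      exact (hC' M hM).trans (le_max_right _ _)

/-- **All-orders bounds on the coefficient field, uniform in the field** (Lemma 6.1 (GammaboundII)
with the Faà di Bruno estimate): for every `j` and `n` there is `C ≥ 0`, depending on nothing else,
such that for every smooth tensor field `T`, every `D > 0` with `‖T‖_∞ ≤ D`, every `Λ ≥ 0` and
every point `y` at which `‖Dⁱ(T∘proj)(y)‖ ≤ (D/c₀) Λⁱ` for `1 ≤ i ≤ n`, one has
`‖Dⁿ(Γ_j(Id + (c₀/D)T) ∘ proj)(y)‖ ≤ C Λⁿ`. (For `n = 1` this is the chain-rule bound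
`|∇Γ_j(Id + c₀𝒟ψ/‖𝒟ψ‖)| ≲ ‖∇𝒟ψ‖_∞/‖𝒟ψ‖_∞` of the proof of Lemma 3.6; for general `n` it is the
input of (abounds) in the proof of Prop. 3.13.)
[cite: CoiculescuPalasek2025, Lemma 6.1 (GammaboundII), Lemma 3.6 (proof), Prop. 3.13 (proof)] -/
theorem exists_norm_iteratedFDeriv_lift_nashField_le (j : Fin 6) (n : ℕ) :
    ∃ C : ℝ, 0 ≤ C ∧ ∀ (T : UnitAddTorus (Fin 3) → (Fin 3 → Fin 3 → ℝ)) (D Λ : ℝ),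
      IsSmooth T → 0 < D → (∀ x, ‖T x‖ ≤ D) → 0 ≤ Λ →
      ∀ y : EuclideanSpace ℝ (Fin 3),
        (∀ i, 1 ≤ i → i ≤ n → ‖iteratedFDeriv ℝ i (lift T) y‖ ≤ D / nashRadius * Λ ^ i) →
        ‖iteratedFDeriv ℝ n (lift (nashField j T D)) y‖ ≤ C * Λ ^ n := by
  obtain ⟨C, hC0, hC⟩ := exists_forall_le_bound_iteratedFDeriv_nashCoeff j n
  refine ⟨n.factorial * C, by positivity, fun T D Λ hT hD hTb hΛ y hy => ?_⟩
  rw [lift_nashField]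
  have hopen : IsOpen (ball idMat (1 / 500 : ℝ) : Set (Fin 3 → Fin 3 → ℝ)) := isOpen_ball
  have hrange : range (lift (nashArg T D)) ⊆ ball idMat (1 / 500) := by
    rintro _ ⟨y, rfl⟩
    rw [lift_apply]
    exact nashArg_mem_ball hD (hTb _)
  have hg : ContDiffOn ℝ (n : WithTop ℕ∞) (nashCoeff j) (ball idMat (1 / 500)) :=
    (contDiffOn_nashCoeff j).mono ball_subset_closedBall
  have hf : ContDiff ℝ (n : WithTop ℕ∞) (lift (nashArg T D)) :=
    (isSmooth_nashArg hT D).of_le (by exact_mod_cast le_top)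
  refine norm_iteratedFDeriv_comp_le' hrange hopen.uniqueDiffOn hg hf (by exact_mod_cast le_rfl) y
    (C := C) (D := Λ) (fun i hi => ?_) (fun i hi1 hin => ?_)
  · -- bounds on `Γ_j` at the argument
    have hmem : lift (nashArg T D) y ∈ ball idMat (1 / 500) := hrange ⟨y, rfl⟩
    rw [iteratedFDerivWithin_of_isOpen i hopen hmem]
    refine hC i hi _ ?_
    rw [lift_apply]
    exact dist_nashArg_idMat_le hD (hTb _)
  · -- bounds on the argument
    rw [norm_iteratedFDeriv_lift_nashArg hi1 hT hD y]
    calc nashRadius / D * ‖iteratedFDeriv ℝ i (lift T) y‖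
        ≤ nashRadius / D * (D / nashRadius * Λ ^ i) := by
          gcongr
          · exact (div_pos nashRadius_pos hD).le
          · exact hy i hi1 hin
      _ = Λ ^ i := by
          field_simp [nashRadius_pos.ne', hD.ne']

/-- **Sup-norm form of the all-orders bound**: under global hypotheses
`‖Dⁱ(T∘proj)‖ ≤ (D/c₀) Λⁱ` (`1 ≤ i ≤ n`), `‖Dⁿ(Γ_j(Id + (c₀/D)T)∘proj)‖ ≤ C Λⁿ` everywhere.
[cite: CoiculescuPalasek2025, Lemma 6.1 (GammaboundII), Prop. 3.13 (proof, (abounds))] -/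
theorem exists_forall_norm_iteratedFDeriv_lift_nashField_le (j : Fin 6) (n : ℕ) :
    ∃ C : ℝ, 0 ≤ C ∧ ∀ (T : UnitAddTorus (Fin 3) → (Fin 3 → Fin 3 → ℝ)) (D Λ : ℝ),
      IsSmooth T → 0 < D → (∀ x, ‖T x‖ ≤ D) → 0 ≤ Λ →
      (∀ i, 1 ≤ i → i ≤ n → ∀ y, ‖iteratedFDeriv ℝ i (lift T) y‖ ≤ D / nashRadius * Λ ^ i) →
      ∀ y : EuclideanSpace ℝ (Fin 3), ‖iteratedFDeriv ℝ n (lift (nashField j T D)) y‖ ≤ C * Λ ^ n := by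
  obtain ⟨C, hC0, hC⟩ := exists_norm_iteratedFDeriv_lift_nashField_le j n
  exact ⟨C, hC0, fun T D Λ hT hD hTb hΛ hy y => hC T D Λ hT hD hTb hΛ y fun i hi1 hin => hy i hi1 hin y⟩

/-- **Order zero**: `‖(Γ_j(…)∘proj)(y)‖ ≤ 1` as a bound on `D⁰`. [cite: CoiculescuPalasek2025, Lemma 6.1 (Gammabound)] -/
theorem norm_iteratedFDeriv_zero_lift_nashField_le (j : Fin 6) (hD : 0 < D) (hTb : ∀ x, ‖T x‖ ≤ D)
    (y : EuclideanSpace ℝ (Fin 3)) : ‖iteratedFDeriv ℝ 0 (lift (nashField j T D)) y‖ ≤ 1 := by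
  rw [norm_iteratedFDeriv_zero, lift_apply, Real.norm_eq_abs]
  exact abs_nashField_le_one j hD (hTb _)

end CP25

end Literature.Analysis.FluidPDE
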